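import Summits.QuantumFields.BalabanUV.Beta.D1BFx.SliceTransferJetsMixed

/-!
# `BalabanUV.Beta.D1BFx.MixedVarPackedHess` — road «BF-x» for binder row D1, slot (K), X₃(ii) ROUTE T, Tier A brick **TA4**
# «TORUS `mixedVar` = TORUS `hess`»: the mixed one-loop functional of the comb-gauged bordered system SEES ONLY THE PACKED
# `(fine ⊕ coarse)`-BLOCKS OF ITS LEG, because the jets have ZERO comb rows — pure finite-dimensional unfolding

HONEST DEPENDENCY (cell records, verbatim): «continuum YM on T⁴ ⇐ BetaPertH ∧ nine spine estimates (0/9 proved); BetaPertH ⇐ (D1) ∧ (D4) ∧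
CAP+tail; G-an2-4 gates asym, D1 and NE2/3/4.»  HONEST FRAMING (cell contract, verbatim): «discharging `BetaPertH` makes Bałaban's UV stability
UNCONDITIONAL — a real constructive-QFT result; it is NOT the continuum limit and NOT the Clay problem.»  THIS MODULE DISCHARGES NOTHING of (K),
of D1 or of the wall: it is [folklore] finite-dimensional matrix algebra (Mathlib) over the cell's own typed objects of
`D1BFx/SliceTransferJetsMixed` (`mixedVar`, `mixedVar_sliceTransfer_jets`; `Composition.kkt`, `Matrix.fromRows`).  ONE bookkeeping data
definition (`hessT`), no `def … : Prop`, nothing cited, 0 sorry.  NOT D1, NOT BetaPertH, NOT continuum, NOT Clay.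

ABSOLUTE RULE (cell charter, verbatim): «No internally-minted statement may enter as a cited fact. Every hypothesis is either kernel-proved in this
package or a verbatim quotation of a PUBLISHED theorem with page reference. The manuscript(s) under audit are NOT citable for their own disputed
steps — they are the thing under adjudication; programme-internal (2001/route/tribunal) claims are never citable.»

WHERE THIS SITS (`HOME/b2b-balaban-beta-d1-p2/K-ASSEMBLY-SPEC.md` v1 §1, brick TA4).  ROUTE T applies the PROVED model identity
`SliceTransferJetsMixed.mixedVar_sliceTransfer_jets` — `mixedVar M + 2·mixedVar F = mixedVar N + 2·mixedVar G` for the comb-gauged sharp bordered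
matrix `M = kkt K₀ [Q₀; τ]`, the R-weighted bordered matrix `N = kkt (K₀ + P₀ᵀP₀) Q₀`, `F = P₀W₀`, `G = τW₀` — on each cubic torus, and then sends the
torus to `ℤ⁴` in the trace functionals (bricks TA1–TA3, TB1–TB5).  For that the four `mixedVar`s must be read as torus one-loop functionals of
LEGS (blocks of inverses), i.e. in the currency of `ExpKernelCalculus.hessKer = ½·tadpole − ½·bubble`.  The only non-trivial point is the
`M`-side: `M` is indexed by THREE sorts `ν ⊕ (μ ⊕ ρ)` (fine bonds, coarse bonds, comb rows) while the jets `kkt Kₛ [Qₛ; 0]` have ZERO comb rows and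
columns, so in `tr(M⁻¹·Jₛₜ) − tr(M⁻¹JₛM⁻¹Jₜ)` only the `(ν ⊕ μ) × (ν ⊕ μ)` blocks of `M⁻¹` enter — the PACKED leg on an2's packed fibre
`Fib = fine ⊕ multiplier` (`OneStepResolventKernel.KInv`'s shape; on the road: the periodised Π_bm-dressed pack, brick TB1).

CONTENT (all [folklore] unless marked [our object]).
* §1 `hessT L V V′ W := ½·((L·W).trace − (L·V·(L·V′)).trace)` [our object] — the finite-index twin of `hessKer`, LEG-valued (no inverse inside);
  `mixedVar_eq_two_mul_hessT : mixedVar A₀ A₁ A₁′ A₂″ = 2·hessT A₀⁻¹ A₁ A₁′ A₂″` and its socket form `mixedVar_eq_two_mul_hessT_of_mul_eq_one`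
  (`A₀·X = 1 → … = 2·hessT X …`) — the `N`∕`F`∕`G` sides.
* §2 THE PACK EMBEDDING `e := Sum.map id Sum.inl : ν ⊕ μ → ν ⊕ (μ ⊕ ρ)` (written out, no definition) and the dictionary of the comb-silent jets:
  `kkt K (fromRows Q 0) (e i) (e j) = kkt K Q i j`, `= 0` on every comb row and comb column (`kkt_fromRows_zero_apply_map`, `…_apply_inr_inr_left/right`).
* §3 ONLY THE PACKED BLOCKS MEET THE JETS: `(X · kkt K [Q;0]).submatrix f e = X.submatrix f e · kkt K Q` (`submatrix_mul_kkt_fromRows_zero`),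
  comb columns of `X · kkt K [Q;0]` vanish, hence `trace_eq_trace_submatrix_of_comb_col_zero`, `submatrix_mul_of_comb_col_zero`, and the two read-outs
  **`trace_mul_kkt_fromRows_zero`**: `(X · kkt K [Q;0]).trace = (X.submatrix e e · kkt K Q).trace` (tadpole) and
  **`trace_mul_kkt_mul_mul_kkt_fromRows_zero`**: `(X·Jₛ^ext·(Y·Jₜ^ext)).trace = (X.submatrix e e·Jₛ·(Y.submatrix e e·Jₜ)).trace` (bubble).
* §4 **`mixedVar_kkt_fromRows_zero`**: `mixedVar M Jₛ^ext Jₜ^ext Jₛₜ^ext = 2·hessT (M⁻¹.submatrix e e) (kkt Kₛ Qₛ) (kkt Kₜ Qₜ) (kkt Kₛₜ Qₛₜ)` for ANY `M` on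
  `ν ⊕ (μ ⊕ ρ)` (no invertibility is needed for the identity), and the LEG socket **`mixedVar_kkt_fromRows_zero_of_mul_eq_one`** (`M·X = 1 →` the same
  with `X.submatrix e e`) — the socket brick TB1 fills.
* §5 block read-outs (which blocks of the leg meet which blocks of the jets): `submatrix_map_inl_fromBlocks` (the packed blocks of a `3 × 3`
  block matrix), `fromBlocks_mul_kkt`, the TADPOLE `trace_fromBlocks_mul_kkt` (`(fromBlocks Γ H H′ S · kkt K Q).trace = (Γ·K).trace + (H·Q).trace +
  (H′·Qᵀ).trace` — field tadpole plus the two border terms) and the BUBBLE `trace_bubble_fromBlocks_kkt` (field–field, two cross, multiplier channels).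
* §6 **`hessT_sliceTransfer_jets`**: `mixedVar_sliceTransfer_jets` RESTATED in the `hessT` currency under its own hypotheses verbatim:
  `hessT (M⁻¹.submatrix e e) Jₛ Jₜ Jₛₜ + 2·hessT (P₀W₀)⁻¹ Fₛ Fₜ Fₛₜ = hessT N⁻¹ Jₛ′ Jₜ′ Jₛₜ′ + 2·hessT (τW₀)⁻¹ (τWₛ) (τWₜ) (τWₛₜ)`.
NOT HERE: periodisation, `ℤ⁴` kernels, the dressed pack, the Ward letters, determinants (bricks TA1–TA3, TB1–TB5).
Provenance: G-an2-4 formalisation swarm leaf seat `b2b-balaban-gan24-formalise-leaf-03` gen 43 (cross-lane, road «BF-x» brick K-TA4), 2026-08-20.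
-/

noncomputable section

namespace Summit.QuantumFields.BalabanUV.Beta.D1BFx.MixedVarPackedHess

open Matrix
open Literature.MathematicalPhysics.QuantumFieldTheory.Balaban1983to89.Beta.Composition (kkt)
open Summit.QuantumFields.BalabanUV.Beta.D1BFx.SliceTransferJetsMixed (mixedVar mixedVar_sliceTransfer_jets)

/-! ## §1 The leg-valued torus one-loop functional `hessT` -/

section HessT

variable {ι : Type*} [Fintype ι]

/-- [our object] **THE TORUS ONE-LOOP FUNCTIONAL IN LEG CURRENCY** `hessT L V V′ W := ½·(tr(L·W) − tr(L·V·(L·V′)))`: half the tadpole of the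
mixed second jet minus half the bubble of the two first jets, the LEG `L` being any matrix (on the road: a block of an inverse, later a
periodised `ℤ⁴` kernel) — the finite-index twin of `ExpKernelCalculus.hessKer`.  A definition asserting nothing. -/
def hessT (L V V' W : Matrix ι ι ℝ) : ℝ :=
  (1 / 2) * ((L * W).trace - (L * V * (L * V')).trace)

/-- [folklore] `2·hessT` is the tadpole-minus-bubble combination. -/
theorem two_mul_hessT (L V V' W : Matrix ι ι ℝ) : 2 * hessT L V V' W = (L * W).trace - (L * V * (L * V')).trace := by
  unfold hessT; ring

/-- [folklore] `hessT` is symmetric in the two first jets (trace cyclicity). -/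
theorem hessT_comm (L V V' W : Matrix ι ι ℝ) : hessT L V V' W = hessT L V' V W := by
  unfold hessT
  rw [Matrix.trace_mul_comm (L * V) (L * V')]

variable [DecidableEq ι]

/-- [folklore] **`mixedVar` IS `2·hessT` OF THE INVERSE LEG** (the `N`-, `F`- and `G`-sides of the slice-transfer identity, by definition). -/
theorem mixedVar_eq_two_mul_hessT (A₀ A₁ A₁' A₂'' : Matrix ι ι ℝ) :
    mixedVar A₀ A₁ A₁' A₂'' = 2 * hessT A₀⁻¹ A₁ A₁' A₂'' := by
  rw [two_mul_hessT]; rfl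

/-- [folklore] LEG SOCKET: if `A₀ · X = 1` then `mixedVar A₀ … = 2·hessT X …`. -/
theorem mixedVar_eq_two_mul_hessT_of_mul_eq_one {A₀ X : Matrix ι ι ℝ} (h : A₀ * X = 1) (A₁ A₁' A₂'' : Matrix ι ι ℝ) :
    mixedVar A₀ A₁ A₁' A₂'' = 2 * hessT X A₁ A₁' A₂'' := by
  rw [mixedVar_eq_two_mul_hessT, Matrix.inv_eq_right_inv h]

/-- [folklore] The same socket with a LEFT inverse `X · A₀ = 1`. -/
theorem mixedVar_eq_two_mul_hessT_of_mul_eq_one_left {A₀ X : Matrix ι ι ℝ} (h : X * A₀ = 1) (A₁ A₁' A₂'' : Matrix ι ι ℝ) :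
    mixedVar A₀ A₁ A₁' A₂'' = 2 * hessT X A₁ A₁' A₂'' := by
  rw [mixedVar_eq_two_mul_hessT, Matrix.inv_eq_left_inv h]

end HessT

/-! ## §2 The pack embedding and the comb-silent jets -/

section Pack

variable {ν μ ρ : Type*}

/-- [folklore] The jet `kkt K [Q; 0]` read on two packed indices is the packed jet `kkt K Q`. -/
theorem kkt_fromRows_zero_apply_map (K : Matrix ν ν ℝ) (Q : Matrix μ ν ℝ) (i j : ν ⊕ μ) :
    kkt K (fromRows Q (0 : Matrix ρ ν ℝ)) (Sum.map id Sum.inl i) (Sum.map id Sum.inl j) = kkt K Q i j := by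
  rcases i with i | i <;> rcases j with j | j <;> rfl

/-- [folklore] The jet `kkt K [Q; 0]` has ZERO comb columns. -/
theorem kkt_fromRows_zero_apply_inr_inr_right (K : Matrix ν ν ℝ) (Q : Matrix μ ν ℝ) (a : ν ⊕ (μ ⊕ ρ)) (r : ρ) :
    kkt K (fromRows Q (0 : Matrix ρ ν ℝ)) a (Sum.inr (Sum.inr r)) = 0 := by
  rcases a with a | a | a <;> rfl

/-- [folklore] The jet `kkt K [Q; 0]` has ZERO comb rows. -/
theorem kkt_fromRows_zero_apply_inr_inr_left (K : Matrix ν ν ℝ) (Q : Matrix μ ν ℝ) (r : ρ) (b : ν ⊕ (μ ⊕ ρ)) :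
    kkt K (fromRows Q (0 : Matrix ρ ν ℝ)) (Sum.inr (Sum.inr r)) b = 0 := by
  rcases b with b | b | b <;> rfl

end Pack

/-! ## §3 Only the packed blocks of a leg meet the jets -/

section Meet

variable {ν μ ρ : Type*} [Fintype ν] [Fintype μ] [Fintype ρ]

/-- [folklore] A sum over the three sorts splits as the packed sum plus the comb sum. -/
theorem sum_three_eq_sum_map_add (f : ν ⊕ (μ ⊕ ρ) → ℝ) :
    ∑ c, f c = (∑ c' : ν ⊕ μ, f (Sum.map id Sum.inl c')) + ∑ r : ρ, f (Sum.inr (Sum.inr r)) := by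
  rw [Fintype.sum_sum_type, Fintype.sum_sum_type, Fintype.sum_sum_type]
  simp only [Sum.map_inl, Sum.map_inr, id_eq]
  ring

/-- [folklore] **ONLY THE PACKED COLUMNS OF THE LEG MEET THE JET**: `(X · kkt K [Q;0]).submatrix f e = X.submatrix f e · kkt K Q`. -/
theorem submatrix_mul_kkt_fromRows_zero {l : Type*} (X : Matrix (ν ⊕ (μ ⊕ ρ)) (ν ⊕ (μ ⊕ ρ)) ℝ) (K : Matrix ν ν ℝ) (Q : Matrix μ ν ℝ)
    (f : l → ν ⊕ (μ ⊕ ρ)) :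
    (X * kkt K (fromRows Q (0 : Matrix ρ ν ℝ))).submatrix f (Sum.map id Sum.inl) =
      X.submatrix f (Sum.map id Sum.inl) * kkt K Q := by
  ext a j
  simp only [Matrix.submatrix_apply, Matrix.mul_apply]
  rw [sum_three_eq_sum_map_add]
  simp only [kkt_fromRows_zero_apply_map, kkt_fromRows_zero_apply_inr_inr_left, mul_zero, Finset.sum_const_zero, add_zero]

/-- [folklore] The comb columns of `X · kkt K [Q;0]` vanish. -/
theorem mul_kkt_fromRows_zero_apply_inr_inr (X : Matrix (ν ⊕ (μ ⊕ ρ)) (ν ⊕ (μ ⊕ ρ)) ℝ) (K : Matrix ν ν ℝ) (Q : Matrix μ ν ℝ)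
    (a : ν ⊕ (μ ⊕ ρ)) (r : ρ) :
    (X * kkt K (fromRows Q (0 : Matrix ρ ν ℝ))) a (Sum.inr (Sum.inr r)) = 0 := by
  simp only [Matrix.mul_apply, kkt_fromRows_zero_apply_inr_inr_right, mul_zero, Finset.sum_const_zero]

/-- [folklore] A matrix with vanishing comb columns has the trace of its packed block. -/
theorem trace_eq_trace_submatrix_of_comb_col_zero {Z : Matrix (ν ⊕ (μ ⊕ ρ)) (ν ⊕ (μ ⊕ ρ)) ℝ}
    (hZ : ∀ a r, Z a (Sum.inr (Sum.inr r)) = 0) :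
    Z.trace = (Z.submatrix (Sum.map id Sum.inl) (Sum.map id Sum.inl)).trace := by
  simp only [Matrix.trace, Matrix.diag_apply, Matrix.submatrix_apply]
  rw [sum_three_eq_sum_map_add]
  simp only [hZ, Finset.sum_const_zero, add_zero]

/-- [folklore] A product whose left factor has vanishing comb columns factors through the packed indices. -/
theorem submatrix_mul_of_comb_col_zero {l o : Type*} {Z₁ : Matrix (ν ⊕ (μ ⊕ ρ)) (ν ⊕ (μ ⊕ ρ)) ℝ}
    (hZ₁ : ∀ a r, Z₁ a (Sum.inr (Sum.inr r)) = 0) (Z₂ : Matrix (ν ⊕ (μ ⊕ ρ)) (ν ⊕ (μ ⊕ ρ)) ℝ) (f : l → ν ⊕ (μ ⊕ ρ))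
    (g : o → ν ⊕ (μ ⊕ ρ)) :
    (Z₁ * Z₂).submatrix f g = Z₁.submatrix f (Sum.map id Sum.inl) * Z₂.submatrix (Sum.map id Sum.inl) g := by
  ext a b
  simp only [Matrix.submatrix_apply, Matrix.mul_apply]
  rw [sum_three_eq_sum_map_add]
  simp only [hZ₁, zero_mul, Finset.sum_const_zero, add_zero]

/-- [folklore] **TADPOLE READ-OUT**: `tr(X · kkt K [Q;0]) = tr(X.submatrix e e · kkt K Q)` — only the packed blocks of the leg enter. -/
theorem trace_mul_kkt_fromRows_zero (X : Matrix (ν ⊕ (μ ⊕ ρ)) (ν ⊕ (μ ⊕ ρ)) ℝ) (K : Matrix ν ν ℝ) (Q : Matrix μ ν ℝ) :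
    (X * kkt K (fromRows Q (0 : Matrix ρ ν ℝ))).trace = (X.submatrix (Sum.map id Sum.inl) (Sum.map id Sum.inl) * kkt K Q).trace := by
  rw [trace_eq_trace_submatrix_of_comb_col_zero (mul_kkt_fromRows_zero_apply_inr_inr X K Q), submatrix_mul_kkt_fromRows_zero]

/-- [folklore] **BUBBLE READ-OUT**: `tr(X·Jₛ^ext·(Y·Jₜ^ext)) = tr(X.submatrix e e·Jₛ·(Y.submatrix e e·Jₜ))` — only the packed blocks of the two
legs enter. -/
theorem trace_mul_kkt_mul_mul_kkt_fromRows_zero (X Y : Matrix (ν ⊕ (μ ⊕ ρ)) (ν ⊕ (μ ⊕ ρ)) ℝ) (Kₛ Kₜ : Matrix ν ν ℝ) (Qₛ Qₜ : Matrix μ ν ℝ) :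
    (X * kkt Kₛ (fromRows Qₛ (0 : Matrix ρ ν ℝ)) * (Y * kkt Kₜ (fromRows Qₜ (0 : Matrix ρ ν ℝ)))).trace =
      (X.submatrix (Sum.map id Sum.inl) (Sum.map id Sum.inl) * kkt Kₛ Qₛ *
        (Y.submatrix (Sum.map id Sum.inl) (Sum.map id Sum.inl) * kkt Kₜ Qₜ)).trace := by
  have h₂ : ∀ a r, (X * kkt Kₛ (fromRows Qₛ (0 : Matrix ρ ν ℝ)) * (Y * kkt Kₜ (fromRows Qₜ (0 : Matrix ρ ν ℝ)))) a
      (Sum.inr (Sum.inr r)) = 0 := by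
    intro a r
    simp only [Matrix.mul_apply (M := X * kkt Kₛ (fromRows Qₛ (0 : Matrix ρ ν ℝ))), mul_kkt_fromRows_zero_apply_inr_inr Y Kₜ Qₜ,
      mul_zero, Finset.sum_const_zero]
  rw [trace_eq_trace_submatrix_of_comb_col_zero h₂,
    submatrix_mul_of_comb_col_zero (mul_kkt_fromRows_zero_apply_inr_inr X Kₛ Qₛ), submatrix_mul_kkt_fromRows_zero,
    submatrix_mul_kkt_fromRows_zero]

end Meet

/-! ## §4 TORUS `mixedVar` = TORUS `hess` on the packed leg -/

section Main

variable {ν μ ρ : Type*} [Fintype ν] [Fintype μ] [Fintype ρ] [DecidableEq ν] [DecidableEq μ] [DecidableEq ρ]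

/-- [folklore] **TA4 — THE MIXED ONE-LOOP FUNCTIONAL OF THE COMB-GAUGED SYSTEM IS `2·hessT` OF THE PACKED BLOCKS OF ITS INVERSE.**  For ANY matrix
`M` on the three sorts `ν ⊕ (μ ⊕ ρ)` and jets with zero comb rows,
`mixedVar M (kkt Kₛ [Qₛ;0]) (kkt Kₜ [Qₜ;0]) (kkt Kₛₜ [Qₛₜ;0]) = 2·hessT (M⁻¹.submatrix e e) (kkt Kₛ Qₛ) (kkt Kₜ Qₜ) (kkt Kₛₜ Qₛₜ)`, `e = Sum.map id Sum.inl`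
— only the `(ν ⊕ μ) × (ν ⊕ μ)` blocks of `M⁻¹` (the packed `fine ⊕ multiplier` leg) enter.  No invertibility hypothesis is needed for the identity. -/
theorem mixedVar_kkt_fromRows_zero (M : Matrix (ν ⊕ (μ ⊕ ρ)) (ν ⊕ (μ ⊕ ρ)) ℝ) (Kₛ Kₜ Kₛₜ : Matrix ν ν ℝ) (Qₛ Qₜ Qₛₜ : Matrix μ ν ℝ) :
    mixedVar M (kkt Kₛ (fromRows Qₛ (0 : Matrix ρ ν ℝ))) (kkt Kₜ (fromRows Qₜ (0 : Matrix ρ ν ℝ)))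
        (kkt Kₛₜ (fromRows Qₛₜ (0 : Matrix ρ ν ℝ))) =
      2 * hessT (M⁻¹.submatrix (Sum.map id Sum.inl) (Sum.map id Sum.inl)) (kkt Kₛ Qₛ) (kkt Kₜ Qₜ) (kkt Kₛₜ Qₛₜ) := by
  rw [two_mul_hessT, mixedVar, trace_mul_kkt_fromRows_zero, trace_mul_kkt_mul_mul_kkt_fromRows_zero]

/-- [folklore] **LEG SOCKET (brick TB1's entry point)**: if `M · X = 1` then the packed blocks of `X` are the leg:
`mixedVar M Jₛ^ext Jₜ^ext Jₛₜ^ext = 2·hessT (X.submatrix e e) Jₛ Jₜ Jₛₜ`. -/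
theorem mixedVar_kkt_fromRows_zero_of_mul_eq_one {M X : Matrix (ν ⊕ (μ ⊕ ρ)) (ν ⊕ (μ ⊕ ρ)) ℝ} (h : M * X = 1)
    (Kₛ Kₜ Kₛₜ : Matrix ν ν ℝ) (Qₛ Qₜ Qₛₜ : Matrix μ ν ℝ) :
    mixedVar M (kkt Kₛ (fromRows Qₛ (0 : Matrix ρ ν ℝ))) (kkt Kₜ (fromRows Qₜ (0 : Matrix ρ ν ℝ)))
        (kkt Kₛₜ (fromRows Qₛₜ (0 : Matrix ρ ν ℝ))) =
      2 * hessT (X.submatrix (Sum.map id Sum.inl) (Sum.map id Sum.inl)) (kkt Kₛ Qₛ) (kkt Kₜ Qₜ) (kkt Kₛₜ Qₛₜ) := by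
  rw [mixedVar_kkt_fromRows_zero, Matrix.inv_eq_right_inv h]

/-- [folklore] The same socket with a LEFT inverse `X · M = 1`. -/
theorem mixedVar_kkt_fromRows_zero_of_mul_eq_one_left {M X : Matrix (ν ⊕ (μ ⊕ ρ)) (ν ⊕ (μ ⊕ ρ)) ℝ} (h : X * M = 1)
    (Kₛ Kₜ Kₛₜ : Matrix ν ν ℝ) (Qₛ Qₜ Qₛₜ : Matrix μ ν ℝ) :
    mixedVar M (kkt Kₛ (fromRows Qₛ (0 : Matrix ρ ν ℝ))) (kkt Kₜ (fromRows Qₜ (0 : Matrix ρ ν ℝ)))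
        (kkt Kₛₜ (fromRows Qₛₜ (0 : Matrix ρ ν ℝ))) =
      2 * hessT (X.submatrix (Sum.map id Sum.inl) (Sum.map id Sum.inl)) (kkt Kₛ Qₛ) (kkt Kₜ Qₜ) (kkt Kₛₜ Qₛₜ) := by
  rw [mixedVar_kkt_fromRows_zero, Matrix.inv_eq_left_inv h]

end Main

/-! ## §5 Block read-outs of the packed leg and of the packed tadpole -/

section Blocks

variable {ν μ ρ : Type*}

/-- [folklore] **THE PACKED BLOCKS OF A `3 × 3` BLOCK MATRIX**: for `X = fromBlocks A (fromCols B₁ B₂) (fromRows C₁ C₂) (fromBlocks D₁₁ D₁₂ D₂₁ D₂₂)` on `ν ⊕ (μ ⊕ ρ)`,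
`X.submatrix e e = fromBlocks A B₁ C₁ D₁₁` (fine–fine, fine–coarse, coarse–fine, coarse–coarse; every comb block dropped). -/
theorem submatrix_map_inl_fromBlocks (A : Matrix ν ν ℝ) (B₁ : Matrix ν μ ℝ) (B₂ : Matrix ν ρ ℝ) (C₁ : Matrix μ ν ℝ) (C₂ : Matrix ρ ν ℝ)
    (D₁₁ : Matrix μ μ ℝ) (D₁₂ : Matrix μ ρ ℝ) (D₂₁ : Matrix ρ μ ℝ) (D₂₂ : Matrix ρ ρ ℝ) :
    (fromBlocks A (fromCols B₁ B₂) (fromRows C₁ C₂) (fromBlocks D₁₁ D₁₂ D₂₁ D₂₂)).submatrix (Sum.map id Sum.inl) (Sum.map id Sum.inl) =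
      fromBlocks A B₁ C₁ D₁₁ := by
  ext i j
  rcases i with i | i <;> rcases j with j | j <;> rfl

variable [Fintype ν] [Fintype μ]

/-- [folklore] **THE PACKED LEG AGAINST A PACKED JET, IN BLOCKS**: `fromBlocks Γ H H′ S · kkt K Q = fromBlocks (Γ·K + H·Q) (Γ·Qᵀ) (H′·K + S·Q) (H′·Qᵀ)`
(the multiplier–multiplier block `S` of the leg meets only the border `Q`; the jet's zero block kills `H·0`, `S·0`). -/
theorem fromBlocks_mul_kkt (Γ : Matrix ν ν ℝ) (H : Matrix ν μ ℝ) (H' : Matrix μ ν ℝ) (S : Matrix μ μ ℝ) (K : Matrix ν ν ℝ)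
    (Q : Matrix μ ν ℝ) :
    fromBlocks Γ H H' S * kkt K Q = fromBlocks (Γ * K + H * Q) (Γ * Qᵀ) (H' * K + S * Q) (H' * Qᵀ) := by
  rw [kkt, Matrix.fromBlocks_multiply]
  simp only [Matrix.mul_zero, add_zero]

/-- [folklore] The trace of a product of two `2 × 2` block matrices, block by block. -/
theorem trace_fromBlocks_mul_fromBlocks (A A' : Matrix ν ν ℝ) (B B' : Matrix ν μ ℝ) (C C' : Matrix μ ν ℝ) (D D' : Matrix μ μ ℝ) :
    (fromBlocks A B C D * fromBlocks A' B' C' D').trace = (A * A').trace + (B * C').trace + ((C * B').trace + (D * D').trace) := by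
  rw [Matrix.fromBlocks_multiply]
  simp only [Matrix.trace, Matrix.diag_apply, Fintype.sum_sum_type, Matrix.fromBlocks_apply₁₁, Matrix.fromBlocks_apply₂₂,
    Matrix.add_apply, Finset.sum_add_distrib]

/-- [folklore] **THE PACKED BUBBLE IN BLOCKS** (which blocks of the leg meet which blocks of the two jets):
`tr((fromBlocks Γ H H′ S · kkt Kₛ Qₛ) · (fromBlocks Γ H H′ S · kkt Kₜ Qₜ))` = field–field channel `tr((ΓKₛ + HQₛ)(ΓKₜ + HQₜ))` + the two
field–multiplier cross channels `tr(ΓQₛᵀ(H′Kₜ + SQₜ)) + tr((H′Kₛ + SQₛ)ΓQₜᵀ)` + the multiplier channel `tr(H′QₛᵀH′Qₜᵀ)`. -/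
theorem trace_bubble_fromBlocks_kkt (Γ : Matrix ν ν ℝ) (H : Matrix ν μ ℝ) (H' : Matrix μ ν ℝ) (S : Matrix μ μ ℝ) (Kₛ Kₜ : Matrix ν ν ℝ)
    (Qₛ Qₜ : Matrix μ ν ℝ) :
    (fromBlocks Γ H H' S * kkt Kₛ Qₛ * (fromBlocks Γ H H' S * kkt Kₜ Qₜ)).trace =
      ((Γ * Kₛ + H * Qₛ) * (Γ * Kₜ + H * Qₜ)).trace + (Γ * Qₛᵀ * (H' * Kₜ + S * Qₜ)).trace +
        (((H' * Kₛ + S * Qₛ) * (Γ * Qₜᵀ)).trace + (H' * Qₛᵀ * (H' * Qₜᵀ)).trace) := by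
  rw [fromBlocks_mul_kkt, fromBlocks_mul_kkt, trace_fromBlocks_mul_fromBlocks]

/-- [folklore] **THE PACKED TADPOLE IN BLOCKS**: `tr(fromBlocks Γ H H′ S · kkt K Q) = tr(Γ·K) + tr(H·Q) + tr(H′·Qᵀ)` — the field tadpole plus the two
border terms (the multiplier–multiplier block of the leg meets the zero block of the jet). -/
theorem trace_fromBlocks_mul_kkt (Γ : Matrix ν ν ℝ) (H : Matrix ν μ ℝ) (H' : Matrix μ ν ℝ) (S : Matrix μ μ ℝ) (K : Matrix ν ν ℝ)
    (Q : Matrix μ ν ℝ) :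
    (fromBlocks Γ H H' S * kkt K Q).trace = (Γ * K).trace + (H * Q).trace + (H' * Qᵀ).trace := by
  rw [kkt, Matrix.fromBlocks_multiply]
  simp only [Matrix.trace, Matrix.diag_apply, Fintype.sum_sum_type, Matrix.fromBlocks_apply₁₁, Matrix.fromBlocks_apply₂₂,
    Matrix.mul_zero, add_zero, Matrix.add_apply, Finset.sum_add_distrib]

/-- [folklore] For a SYMMETRIC border pair (`H′ = Hᵀ`) the two border terms coincide: `tr(H′·Qᵀ) = tr(H·Q)`. -/
theorem trace_fromBlocks_mul_kkt_of_transpose (Γ : Matrix ν ν ℝ) (H : Matrix ν μ ℝ) (S : Matrix μ μ ℝ) (K : Matrix ν ν ℝ)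
    (Q : Matrix μ ν ℝ) :
    (fromBlocks Γ H Hᵀ S * kkt K Q).trace = (Γ * K).trace + 2 * (H * Q).trace := by
  rw [trace_fromBlocks_mul_kkt, ← Matrix.transpose_mul, Matrix.trace_transpose, Matrix.trace_mul_comm Q H]
  ring

end Blocks

/-! ## §6 The slice-transfer identity in the torus-`hess` currency -/

section Transfer

variable {ν μ ρ : Type*} [Fintype ν] [Fintype μ] [Fintype ρ] [DecidableEq ν] [DecidableEq μ] [DecidableEq ρ]

/-- [folklore] **K-R1 AT MODEL LEVEL, JET FORM, IN THE TORUS-`hess` CURRENCY** (`SliceTransferJetsMixed.mixedVar_sliceTransfer_jets` restated through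
§1 and §4, hypotheses verbatim): with `e = Sum.map id Sum.inl`,
`hessT ((kkt K₀ [Q₀;τ])⁻¹.submatrix e e) (kkt Kₛ Qₛ) (kkt Kₜ Qₜ) (kkt Kₛₜ Qₛₜ) + 2·hessT (P₀W₀)⁻¹ Fₛ Fₜ Fₛₜ
   = hessT (kkt (K₀ + P₀ᵀP₀) Q₀)⁻¹ Jₛ′ Jₜ′ Jₛₜ′ + 2·hessT (τW₀)⁻¹ (τWₛ) (τWₜ) (τWₛₜ)`
— the packed `(fine ⊕ coarse)` leg of the comb-gauged sharp system on the left, the R-weighted bordered leg on the right, the Faddeev–Popov and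
comb-Gram legs as scalar-sort corrections. -/
theorem hessT_sliceTransfer_jets (K₀ Kₛ Kₜ Kₛₛ Kₜₜ Kₛₜ : Matrix ν ν ℝ) (Q₀ Qₛ Qₜ Qₛₛ Qₜₜ Qₛₜ : Matrix μ ν ℝ)
    (P₀ Pₛ Pₜ Pₛₛ Pₜₜ Pₛₜ : Matrix ρ ν ℝ) (W₀ Wₛ Wₜ Wₛₛ Wₜₜ Wₛₜ : Matrix ν ρ ℝ) (τ : Matrix ρ ν ℝ)
    (a0 : K₀ * W₀ = 0) (a0t : K₀ᵀ * W₀ = 0)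
    (aₛ : Kₛ * W₀ + K₀ * Wₛ = 0) (aₛt : Kₛᵀ * W₀ + K₀ᵀ * Wₛ = 0) (aₜ : Kₜ * W₀ + K₀ * Wₜ = 0) (aₜt : Kₜᵀ * W₀ + K₀ᵀ * Wₜ = 0)
    (aₛₛ : Kₛₛ * W₀ + (2 : ℝ) • (Kₛ * Wₛ) + K₀ * Wₛₛ = 0) (aₛₛt : Kₛₛᵀ * W₀ + (2 : ℝ) • (Kₛᵀ * Wₛ) + K₀ᵀ * Wₛₛ = 0)
    (aₜₜ : Kₜₜ * W₀ + (2 : ℝ) • (Kₜ * Wₜ) + K₀ * Wₜₜ = 0) (aₜₜt : Kₜₜᵀ * W₀ + (2 : ℝ) • (Kₜᵀ * Wₜ) + K₀ᵀ * Wₜₜ = 0)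
    (aₛₜ : Kₛₜ * W₀ + Kₛ * Wₜ + Kₜ * Wₛ + K₀ * Wₛₜ = 0) (aₛₜt : Kₛₜᵀ * W₀ + Kₛᵀ * Wₜ + Kₜᵀ * Wₛ + K₀ᵀ * Wₛₜ = 0)
    (b0 : Q₀ * W₀ = 0) (bₛ : Qₛ * W₀ + Q₀ * Wₛ = 0) (bₜ : Qₜ * W₀ + Q₀ * Wₜ = 0)
    (bₛₛ : Qₛₛ * W₀ + (2 : ℝ) • (Qₛ * Wₛ) + Q₀ * Wₛₛ = 0) (bₜₜ : Qₜₜ * W₀ + (2 : ℝ) • (Qₜ * Wₜ) + Q₀ * Wₜₜ = 0)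
    (bₛₜ : Qₛₜ * W₀ + Qₛ * Wₜ + Qₜ * Wₛ + Q₀ * Wₛₜ = 0)
    (hτ : (τ * W₀).det ≠ 0) (hP : (P₀ * W₀).det ≠ 0) (hM : (kkt K₀ (fromRows Q₀ τ)).det ≠ 0) :
    hessT ((kkt K₀ (fromRows Q₀ τ))⁻¹.submatrix (Sum.map id Sum.inl) (Sum.map id Sum.inl)) (kkt Kₛ Qₛ) (kkt Kₜ Qₜ) (kkt Kₛₜ Qₛₜ)
      + 2 * hessT (P₀ * W₀)⁻¹ (Pₛ * W₀ + P₀ * Wₛ) (Pₜ * W₀ + P₀ * Wₜ) (Pₛₜ * W₀ + Pₛ * Wₜ + Pₜ * Wₛ + P₀ * Wₛₜ)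
    = hessT (kkt (K₀ + P₀ᵀ * P₀) Q₀)⁻¹ (kkt (Kₛ + (Pₛᵀ * P₀ + P₀ᵀ * Pₛ)) Qₛ) (kkt (Kₜ + (Pₜᵀ * P₀ + P₀ᵀ * Pₜ)) Qₜ)
        (kkt (Kₛₜ + (Pₛₜᵀ * P₀ + Pₛᵀ * Pₜ + Pₜᵀ * Pₛ + P₀ᵀ * Pₛₜ)) Qₛₜ)
      + 2 * hessT (τ * W₀)⁻¹ (τ * Wₛ) (τ * Wₜ) (τ * Wₛₜ) := by
  have h := mixedVar_sliceTransfer_jets K₀ Kₛ Kₜ Kₛₛ Kₜₜ Kₛₜ Q₀ Qₛ Qₜ Qₛₛ Qₜₜ Qₛₜ P₀ Pₛ Pₜ Pₛₛ Pₜₜ Pₛₜ W₀ Wₛ Wₜ Wₛₛ Wₜₜ Wₛₜ τ a0 a0t aₛ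
    aₛt aₜ aₜt aₛₛ aₛₛt aₜₜ aₜₜt aₛₜ aₛₜt b0 bₛ bₜ bₛₛ bₜₜ bₛₜ hτ hP hM
  rw [mixedVar_kkt_fromRows_zero, mixedVar_eq_two_mul_hessT (P₀ * W₀), mixedVar_eq_two_mul_hessT (kkt (K₀ + P₀ᵀ * P₀) Q₀),
    mixedVar_eq_two_mul_hessT (τ * W₀)] at h
  linarith

end Transfer

end Summit.QuantumFields.BalabanUV.Beta.D1BFx.MixedVarPackedHess

end
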